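import Literature.Probability.Percolation.MarkedLoopBoundaryLawModule
import Literature.Probability.Percolation.MarkedLoopSiteLawPattern
import Literature.Probability.Percolation.PolylineTransitFaces
import HarnessLib

/-!
# The SLIDE identity of the boundary link-pattern law: one mark moved across one attached hexagon («LAW-SLIDE»)

Topic `Literature/Probability/Percolation`; generic-`k` layer of the marked-loop (Khristoforov–Smirnov) lineage; the first ONE-HEXAGON SURGERY identity of
HOME `FINDING-BSPAN-SLIDE-INDUCTION.md` §2 / §4 (G2), in the lane's `TXb` / `patternCount` / `lawLP` vocabulary.

SETTING. Three `k`-marked discrete domains on two site sets: `D₁`, `D₂` on `G` and `D'` on `G' = G ∪ {h}`, `h ∉ G` a hexagon attached to `G` along ONE contact arc: in the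
ring coordinates of `h` (directions `triDir (r + k)`, `k : Fin 6`, anticlockwise from an offset `r`) the neighbours at offsets `k ≤ m` lie OUTSIDE `G` and those at offsets
`k > m` inside (`1 ≤ m ≤ 4`). Around `h` the faces `N_k = leftFaceDir h (r + k)` are: the first contact end `P = N_5`, the interior vertices `N_k`, `k < m`, of the outer
path of `h` (they touch `G'` but not `G`), and the last contact end `Q = N_m`; the new `H_{G'}`-bonds are `nb k = s(h, h + triDir (r + k))`, `k ≤ m` (the outer path
`P — N_0 — ⋯ — N_{m-1} — Q`). The marks: all corner faces agree except the `i₀`-th, which is `Q` in `D₁`, `P` in `D₂` and `a = N_{k₀}` (`k₀ < m`) in `D'` — ONE MARK SLID from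
the contact end `q` (resp. `p`) of `Ω` onto the outer path of the attached hexagon (`SlideData`).

* §1 (edge sets, `D`-free): `xiDeg_union_of_disjoint`; ★ `reachable_union_pendant` / `reachable_union_pendant_root` — attaching a PENDANT edge set `E` (its bonds live on
  a set `S` of otherwise edge-free faces and one root face `R`) changes no link among faces off `S`, and links a face of `S` joined to `R` inside `E` exactly to what `R`
  is linked to.
* §2 (one hexagon, `D`-free): `nbond h j = {h, h + e_j}`; the sides of `N_j = leftFaceDir h j` (`side_N_idx`, `side_N_idx_add_one/two`, `side_N_eq_or`), the two faces of
  `nbond h j` (`eq_N_or_of_inc`), `odd_xiDeg_iff_not_iff` (parity of a face with one side excluded), `exists_eq_N_of_mem`.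
* §3 `SlideData` and its consequences: `mem_hBonds'_iff` (`H_{G'} = H_G ⊔ {nb k : k ≤ m}`), `nb_not_mem_hBonds₁`, `outer_not_mem_hBonds'`, `N_not_touching`,
  `mem_touching'_iff`; the corner faces (`mem_corners'_iff`, `Q_corners`, `P_corners`, `N_corners`); the two half-paths `EQ` (after `a`, to `Q`) and `EP` (up to `a`, from `P`)
  as `CaseData` (`caseQ` for `D₁`, `caseP` for `D₂`); for case data: ★★ `parityIs_union_iff` / `union_mem_TXb_iff` — adding the half-path is a bijection from the
  configurations of the small domain onto the configurations of `D'` with that half-path, ★ `inClassX_union_iff` / `linkRel_union_eq` — preserving partner and link relation,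
  ★★ `card_filter_case_eq`; ★ `nbond_mem_iff_of_mem_TXb` — THE PARITY WALK along the outer path (the new bonds present flip exactly once, at `a`) and `cases_of_mem_TXb` (so
  they are exactly `EQ` or exactly `EP`).
* §4 ★★★ `SlideData.patternCount_eq_add` — **THE SLIDE IDENTITY FOR THE PATTERN COUNTS**: `N_p^{D'}(z) = N_p^{D₁}(z) + N_p^{D₂}(z)` for every pattern `p` and every
  `H_G`-edge `z`; ★★★ `SlideData.lawLP_eq_add` — **`lawLP z' = lawLP z₁ + lawLP z₂`** in the planar Temperley–Lieb module for home-arc mid-edges read at the same face and side.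

Colouring-model derivation (HOME finding §2): condition on the colour of `h`; the two colours give the two terms. Loop-model proof (here): restrict a configuration of
`G'` to the bonds of `G`; parity along the outer path of `h` flips exactly at `a`, so exactly one of the two end bonds is present and the restriction has its odd contact end
at `Q` or at `P`; the strand through `a` is the strand through that end, prolonged along the path.

## References
* M. Khristoforov, S. Smirnov, *Percolation and O(1) loop model*, arXiv:2111.15612 (2021), §1.2 (arXiv v1 p. 2: loop configurations with disorders, the link pattern
  `IP(ξ)` «is a union of disjoint paths, matching marked points»; p. 3: the colouring ↔ loop-configuration correspondence), §2 Definition 3 (p. 4), Remark 6 (p. 5).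
* B. Bollobás, O. Riordan, *Percolation*, CUP (2006), Ch. 7 §7.2.2 (pp. 168–169; 191–195): discrete domains, marked sites, arcs.
* P. A. Pearce, V. Rittenberg, J. de Gier, B. Nienhuis, *Temperley–Lieb stochastic processes*, J. Phys. A 35 (2002) L661–L668, §2 (the link-pattern module).

## Mathlib / tree
Mathlib: `SimpleGraph.Walk` (induction on length), `SimpleGraph.Reachable.mono`, `Finset.card_bij`, `Finset.filter_or`, `Finset.card_union_of_disjoint`, `Finsupp.ext`.
Tree: `KhSThreeDisorderObservable` (`TXb`, `mem_TXb_iff`, `ParityIs`, `InClassX`, `hbK_inClassX_iff`), `MarkedLoopSpace` (`hBonds`, `mem_hBonds`, `exists_rep_of_mem_hBonds`,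
`mem_touching_of_side_mem`, `corners`, `yc`, `yc_injective`, `yc_mem_touching`, `mem_corners`), `MarkedLoopHolomorphy` (`linkRel`, `mem_linkRel`), `MarkedLoopTripodBasis`
(`Pat`, `patternCount`), `MarkedLoopBoundaryLawModule` (`lawLP`, `lawLP_apply`), `MarkedLoopBoundarySpan` (`ArcPoint`), `FivePointNormalisation` (`N5.sideGraph`,
`xiLinked_iff_reachable`, `side_oppFace_oppIdx`, `l1_xiDeg_eq`), `PolylineTransitFaces` (`oppFace_leftFaceDir_next/right`, `faceVertex_leftFaceDir_*`, `fin6_val_add_one`),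
`TriDiscShelling` (`leftFaceDir`, `leftFaceIdx`, `RemovableAt.hexFaceVertices_leftFaceDir`, `RemovableAt.leftFaceDir_injective`, `facesAt_eq_image_leftFaceDir`,
`mem_triFacesTouching`, `triGraph_adj_iff_triDir`, `add_triDir_ne`), `TriChordSides` (`eq_leftFace_or_of_mem_of_mem`), `TriFaceLabel` (`leftFace_add_triDir(_rev)`).
-/

open Finset

namespace Literature.Probability.Percolation.MarkedLoops

open Literature.Probability.Percolation Literature.Probability.LatticeModels
open Literature.Probability.Percolation.FivePoint (side side_injective XiLinked Inc inc_side inc_mk_iff xiDeg)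
open Literature.Probability.Percolation.FivePoint.N5 (sideGraph side_oppFace_oppIdx xiLinked_iff_reachable l1_xiDeg_eq ht2_sideGraph_mono)
open TriMarkedDomain

/-! ## §1 Edge sets: disjoint unions and pendant attachments (`D`-free) -/

section EdgeSets

/-- the side count is additive over disjoint edge sets. [cite: KhristoforovSmirnov2021, §1.2 (arXiv v1 p. 2: loop configurations)] -/
theorem xiDeg_union_of_disjoint {ξ E : Finset (Sym2 (Site 2))} (h : Disjoint ξ E) (F : HexVertex) :
    xiDeg (ξ ∪ E) F = xiDeg ξ F + xiDeg E F := by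
  classical
  rw [l1_xiDeg_eq, l1_xiDeg_eq, l1_xiDeg_eq]
  have e : ((Finset.univ : Finset (Fin 3)).filter fun j => side F j ∈ ξ ∪ E) =
      ((Finset.univ : Finset (Fin 3)).filter fun j => side F j ∈ ξ) ∪ ((Finset.univ : Finset (Fin 3)).filter fun j => side F j ∈ E) := by
    rw [← Finset.filter_or]
    exact Finset.filter_congr fun j _ => Finset.mem_union
  rw [e, Finset.card_union_of_disjoint]
  rw [Finset.disjoint_left]
  intro j hj hj'
  exact Finset.disjoint_left.1 h (Finset.mem_filter.1 hj).2 (Finset.mem_filter.1 hj').2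

variable {ξ E : Finset (Sym2 (Site 2))} {S : Finset HexVertex} {R : HexVertex}

/-- **excursion cutting for a pendant attachment.** `E` is attached to `ξ` PENDANTLY at the root `R` through the faces `S`: every side of a face of `S` lying in `ξ ∪ E`
lies in `E`, every face off `S ∪ {R}` has no side in `E`, and `ξ`, `E` are disjoint. Then a walk of the side graph of `ξ ∪ E` ending off `S` reduces to a walk of the side
graph of `ξ` — from its start if the start is off `S`, from the root `R` if the start is in `S`. [cite: KhristoforovSmirnov2021, §1.2 (arXiv v1 p. 2: `IP(ξ)` is a union of disjoint paths)] -/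
theorem reachable_of_walk_union_pendant (hS : ∀ F ∈ S, ∀ j : Fin 3, side F j ∈ ξ ∪ E → side F j ∈ E)
    (hR : ∀ F, F ∉ S → F ≠ R → ∀ j : Fin 3, side F j ∉ E) (hdisj : Disjoint ξ E) {Y : HexVertex} (hY : Y ∉ S) (n : ℕ) :
    ∀ {X : HexVertex} (p : (sideGraph (ξ ∪ E)).Walk X Y), p.length ≤ n →
      (X ∉ S → (sideGraph ξ).Reachable X Y) ∧ (X ∈ S → (sideGraph ξ).Reachable R Y) := by
  induction n with
  | zero =>
    intro X p hp
    cases p with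
    | nil => exact ⟨fun _ => SimpleGraph.Reachable.refl _, fun h => absurd h hY⟩
    | cons h q => simp at hp
  | succ n ih =>
    intro X p hp
    cases p with
    | nil => exact ⟨fun _ => SimpleGraph.Reachable.refl _, fun h => absurd h hY⟩
    | cons hadj q =>
      rename_i X₁
      rw [SimpleGraph.Walk.length_cons] at hp
      obtain ⟨j, hX₁, hj⟩ := hadj
      have hq := ih q (by omega)
      -- the side `side X j = side X₁ (oppIdx X j)` is a side of both faces
      have hjX₁ : side X₁ (oppIdx X j) = side X j := by rw [hX₁, side_oppFace_oppIdx]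
      constructor
      · intro hX
        rcases Finset.mem_union.1 hj with hjξ | hjE
        · -- a `ξ`-step: the next face is off `S` (else the bond would lie in `E`)
          have hX₁S : X₁ ∉ S := by
            intro h1
            have := hS X₁ h1 (oppIdx X j) (by rw [hjX₁]; exact hj)
            rw [hjX₁] at this
            exact Finset.disjoint_left.1 hdisj hjξ this
          exact (show (sideGraph ξ).Adj X X₁ from ⟨j, hX₁, hjξ⟩).reachable.trans ((hq).1 hX₁S)
        · -- an `E`-step from off `S`: the start is the root, the next face is in `S`
          have hXR : X = R := by
            by_contra hne
            exact hR X hX hne j hjE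
          subst hXR
          by_cases hX₁S : X₁ ∈ S
          · exact hq.2 hX₁S
          · have hX₁R : X₁ ≠ X := fun e => (hexGraph_adj_oppFace X j).ne (e ▸ hX₁ : X = oppFace X j)
            exact absurd (hjX₁ ▸ hjE : side X₁ (oppIdx X j) ∈ E) (hR X₁ hX₁S hX₁R _)
      · intro hX
        -- a step from a face of `S` runs along a bond of `E`, to a face of `S` or to the root
        have hjE : side X j ∈ E := hS X hX j hj
        by_cases hX₁S : X₁ ∈ S
        · exact hq.2 hX₁S
        · have hX₁R : X₁ = R := by
            by_contra hne
            exact hR X₁ hX₁S hne (oppIdx X j) (by rw [hjX₁]; exact hjE)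
          rw [← hX₁R]
          exact hq.1 hX₁S

/-- ★ **a pendant attachment changes no link off `S`**: for faces `X, Y ∉ S`, `X` and `Y` are linked in `ξ ∪ E` iff they are linked in `ξ`.
[cite: KhristoforovSmirnov2021, §1.2 (arXiv v1 p. 2: `IP(ξ)` is a union of disjoint paths)] -/
theorem reachable_union_pendant (hS : ∀ F ∈ S, ∀ j : Fin 3, side F j ∈ ξ ∪ E → side F j ∈ E)
    (hR : ∀ F, F ∉ S → F ≠ R → ∀ j : Fin 3, side F j ∉ E) (hdisj : Disjoint ξ E) {X Y : HexVertex} (hX : X ∉ S) (hY : Y ∉ S) :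
    (sideGraph (ξ ∪ E)).Reachable X Y ↔ (sideGraph ξ).Reachable X Y := by
  constructor
  · rintro ⟨p⟩
    exact (reachable_of_walk_union_pendant hS hR hdisj hY p.length p le_rfl).1 hX
  · exact fun h => h.mono (ht2_sideGraph_mono Finset.subset_union_left)

/-- ★ **… and links a face of `S` joined to the root inside `E` exactly to what the root is linked to in `ξ`.**
[cite: KhristoforovSmirnov2021, §1.2 (arXiv v1 p. 2: `IP(ξ)` is a union of disjoint paths)] -/
theorem reachable_union_pendant_root (hS : ∀ F ∈ S, ∀ j : Fin 3, side F j ∈ ξ ∪ E → side F j ∈ E)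
    (hR : ∀ F, F ∉ S → F ≠ R → ∀ j : Fin 3, side F j ∉ E) (hdisj : Disjoint ξ E) {A Y : HexVertex} (hA : A ∈ S) (hY : Y ∉ S)
    (hAR : (sideGraph E).Reachable A R) :
    (sideGraph (ξ ∪ E)).Reachable A Y ↔ (sideGraph ξ).Reachable R Y := by
  constructor
  · rintro ⟨p⟩
    exact (reachable_of_walk_union_pendant hS hR hdisj hY p.length p le_rfl).2 hA
  · intro h
    exact (hAR.mono (ht2_sideGraph_mono Finset.subset_union_right)).trans (h.mono (ht2_sideGraph_mono Finset.subset_union_left))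

end EdgeSets

/-! ## §2 One attached hexagon: faces, sides and bonds around `h` -/

section Hexagon

variable {h : Site 2}

/-- **the bond `{h, h + e_j}`** of `𝕋` (dual to the `H`-edge of the hexagon `H_h` perpendicular to `e_j`). [cite: KhristoforovSmirnov2021, §1.2 (arXiv v1 p. 2: the edges of `H_Ω`); lane tool notion] -/
def nbond (h : Site 2) (j : Fin 6) : Sym2 (Site 2) := s(h, h + triDir j)

/-- `nbond h` is injective. [cite: BollobasRiordan2006, Ch. 7 §7.2.2 p. 168; lane plumbing] -/
theorem nbond_inj {h : Site 2} {j j' : Fin 6} (e : nbond h j = nbond h j') : j = j' := by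
  unfold nbond at e
  rcases Sym2.eq_iff.1 e with ⟨-, h2⟩ | ⟨h1, -⟩
  · exact triDir_injective (add_left_cancel h2)
  · exact absurd h1.symm (add_triDir_ne h j')

/-- `h ∈ nbond h j`, so a bond avoiding `h` is not an `nbond h`. [cite: BollobasRiordan2006, Ch. 7 §7.2.2 p. 168; lane plumbing] -/
theorem outer_ne_nbond (h : Site 2) (j j' l : Fin 6) : s(h + triDir j, h + triDir j') ≠ nbond h l := by
  intro e
  have hm : h ∈ (s(h + triDir j, h + triDir j') : Sym2 (Site 2)) := by rw [e]; exact Sym2.mem_mk_left _ _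
  rcases Sym2.mem_iff.1 hm with e1 | e1
  · exact add_triDir_ne h j e1.symm
  · exact add_triDir_ne h j' e1.symm

/-- the three side indices of `N_j`. [cite: BollobasRiordan2006, Ch. 7 §7.2.2 p. 168; lane plumbing] -/
private theorem fin3_cases_idx (a i : Fin 3) : i = a ∨ i = a + 1 ∨ i = a + 2 := by
  revert a i; decide

/-- the OUTER side of `N_j`: `{h + e_j, h + e_{j+1}}`. [cite: BollobasRiordan2006, Ch. 7 §7.2.2 p. 168; lane plumbing] -/
theorem side_N_idx (h : Site 2) (j : Fin 6) : side (leftFaceDir h j) (leftFaceIdx j) = s(h + triDir j, h + triDir (j + 1)) := by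
  unfold side
  rw [faceVertex_leftFaceDir_succ, show leftFaceIdx j + 2 = leftFaceIdx j + 1 + 1 from by rw [add_assoc]; rfl, faceVertex_leftFaceDir_one_one]

/-- the side of `N_j` towards `N_{j+1}`: `{h, h + e_{j+1}}`. [cite: BollobasRiordan2006, Ch. 7 §7.2.2 p. 168; lane plumbing] -/
theorem side_N_idx_add_one (h : Site 2) (j : Fin 6) : side (leftFaceDir h j) (leftFaceIdx j + 1) = nbond h (j + 1) := by
  unfold side nbond
  rw [faceVertex_leftFaceDir_one_one, faceVertex_leftFaceDir_one_two, Sym2.eq_swap]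

/-- the side of `N_j` towards `N_{j-1}`: `{h, h + e_j}`. [cite: BollobasRiordan2006, Ch. 7 §7.2.2 p. 168; lane plumbing] -/
theorem side_N_idx_add_two (h : Site 2) (j : Fin 6) : side (leftFaceDir h j) (leftFaceIdx j + 2) = nbond h j := by
  unfold side nbond
  rw [faceVertex_leftFaceDir_two_one, faceVertex_leftFaceDir_two_two]

/-- **every side of `N_j` is one of the three.** [cite: BollobasRiordan2006, Ch. 7 §7.2.2 p. 168; lane plumbing] -/
theorem side_N_eq_or (h : Site 2) (j : Fin 6) (i : Fin 3) :
    side (leftFaceDir h j) i = s(h + triDir j, h + triDir (j + 1)) ∨ side (leftFaceDir h j) i = nbond h (j + 1) ∨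
      side (leftFaceDir h j) i = nbond h j := by
  rcases fin3_cases_idx (leftFaceIdx j) i with rfl | rfl | rfl
  · exact Or.inl (side_N_idx h j)
  · exact Or.inr (Or.inl (side_N_idx_add_one h j))
  · exact Or.inr (Or.inr (side_N_idx_add_two h j))

/-- **the two faces of the bond `{h, h + e_j}`** are `N_j` and `N_{j+5}`. [cite: BollobasRiordan2006, Ch. 7 §7.2.2 p. 168; lane plumbing] -/
theorem eq_N_or_of_inc {F : HexVertex} (j : Fin 6) (hF : Inc F (nbond h j)) : F = leftFaceDir h j ∨ F = leftFaceDir h (j + 5) := by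
  obtain ⟨h1, h2⟩ := inc_mk_iff.1 hF
  rcases eq_leftFace_or_of_mem_of_mem (triGraph_adj_add_triDir h j) h1 h2 with e | e
  · exact Or.inl (e.trans (leftFace_add_triDir h j))
  · exact Or.inr (e.trans (leftFace_add_triDir_rev h j))

/-- a face none of whose vertices is `h` has no side `nbond h j`. [cite: BollobasRiordan2006, Ch. 7 §7.2.2 p. 168; lane plumbing] -/
theorem side_ne_nbond_of_not_mem {F : HexVertex} (hF : h ∉ hexFaceVertices F) (i : Fin 3) (j : Fin 6) : side F i ≠ nbond h j := by
  intro e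
  have : Inc F (nbond h j) := by rw [← e]; exact inc_side F i
  exact hF (inc_mk_iff.1 this).1

/-- **parity of a face with one side excluded**: if the `a`-th side is absent, the side count is odd iff exactly one of the two other sides is present.
[cite: KhristoforovSmirnov2021, §1.2 (arXiv v1 p. 2: loop configurations)] -/
theorem odd_xiDeg_iff_not_iff {E : Finset (Sym2 (Site 2))} {F : HexVertex} (a : Fin 3) (ha : side F a ∉ E) :
    Odd (xiDeg E F) ↔ ¬ (side F (a + 1) ∈ E ↔ side F (a + 2) ∈ E) := by
  classical
  rw [l1_xiDeg_eq]
  have h12 : (a + 1 : Fin 3) ≠ a + 2 := by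
    have : ∀ b : Fin 3, b + 1 ≠ b + 2 := by decide
    exact this a
  have e : ((Finset.univ : Finset (Fin 3)).filter fun j => side F j ∈ E) = (({a + 1, a + 2} : Finset (Fin 3))).filter fun j => side F j ∈ E := by
    ext j
    simp only [Finset.mem_filter, Finset.mem_univ, true_and, Finset.mem_insert, Finset.mem_singleton]
    constructor
    · intro hj
      refine ⟨?_, hj⟩
      rcases fin3_cases_idx a j with rfl | rfl | rfl
      · exact absurd hj ha
      · exact Or.inl rfl
      · exact Or.inr rfl
    · exact fun hj => hj.2
  rw [e, Finset.filter_insert, Finset.filter_singleton]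
  by_cases h1 : side F (a + 1) ∈ E <;> by_cases h2 : side F (a + 2) ∈ E <;> simp only [h1, h2, if_true, if_false]
  · rw [Finset.card_pair h12, Nat.odd_iff]; decide
  · rw [Finset.insert_empty, Finset.card_singleton, Nat.odd_iff]; decide
  · rw [Finset.card_singleton, Nat.odd_iff]; decide
  · rw [Finset.card_empty, Nat.odd_iff]; decide

/-- `N_j` is injective in `j`. [cite: BollobasRiordan2006, Ch. 7 §7.2.2 p. 168; lane plumbing] -/
theorem N_inj {r k k' : Fin 6} (e : leftFaceDir h (r + k) = leftFaceDir h (r + k')) : k = k' :=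
  add_left_cancel (RemovableAt.leftFaceDir_injective h e)

/-- a face containing `h` is some `N_{r+k}`. [cite: BollobasRiordan2006, Ch. 7 §7.2.2 p. 168; lane plumbing] -/
theorem exists_eq_N_of_mem (r : Fin 6) {F : HexVertex} (hF : h ∈ hexFaceVertices F) : ∃ k : Fin 6, F = leftFaceDir h (r + k) := by
  have hm : F ∈ facesAt h := mem_facesAt.2 hF
  rw [facesAt_eq_image_leftFaceDir] at hm
  obtain ⟨j, -, rfl⟩ := Finset.mem_image.1 hm
  exact ⟨j - r, by rw [add_sub_cancel]⟩

end Hexagon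

/-! ## §3 The slide datum: three marked domains around one attached hexagon -/

section Slide

variable {nm : ℕ}

/-- **ONE MARK SLID ACROSS ONE ATTACHED HEXAGON.** Three `k`-marked discrete domains: `D₁`, `D₂` on the sites `G`, `D'` on `G ∪ {h}` with `h ∉ G` attached along one
contact arc — in the ring coordinates `triDir (r + k)` of `h` the neighbours at offsets `k ≤ m` are outside `G`, those at offsets `k > m` inside (`m ≤ 4`); all corner
faces agree except the `i₀`-th, which is the last contact end `Q = N_m` in `D₁`, the first contact end `P = N_5` in `D₂`, and the outer-path vertex `a = N_{k₀}`, `k₀ < m`,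
in `D'` (`N_k = leftFaceDir h (r + k)`). In the colouring language of HOME `FINDING-BSPAN-SLIDE-INDUCTION.md` §2: `D₁ = (Ω; M - p + q)`, `D₂ = (Ω; M)` with `p ∈ M`,
`D' = (Ω ∪ h; M - p + a)`. [cite: KhristoforovSmirnov2021, §1.2 (arXiv v1 p. 2: marked points / disorders on the boundary); BollobasRiordan2006, Ch. 7 §7.2.2 pp. 168–169] -/
structure SlideData (D' D₁ D₂ : TriMarkedDomain nm) (h : Site 2) (r m k₀ : Fin 6) (i₀ : Fin nm) : Prop where
  /-- the big domain is the small one plus the hexagon `h` -/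
  verts' : D'.verts = insert h D₁.verts
  /-- the two small domains have the same sites -/
  verts₂ : D₂.verts = D₁.verts
  /-- `h` is a new site -/
  not_mem : h ∉ D₁.verts
  /-- the outer run of `h`: offsets `k ≤ m` are outside `G` … -/
  out : ∀ k : Fin 6, k ≤ m → h + triDir (r + k) ∉ D₁.verts
  /-- … and the contact arc: offsets `k > m` are inside `G` -/
  inside : ∀ k : Fin 6, m < k → h + triDir (r + k) ∈ D₁.verts
  /-- at least one contact cell -/
  m_le : m.val ≤ 4
  /-- the slid mark sits strictly inside the outer path -/
  k₀_lt : k₀ < m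
  /-- the other corner faces of `D'` are those of `D₁` … -/
  yc' : ∀ i, i ≠ i₀ → yc D' i = yc D₁ i
  /-- … and so are those of `D₂` -/
  yc₂ : ∀ i, i ≠ i₀ → yc D₂ i = yc D₁ i
  /-- the slid mark of `D'` is at `a = N_{k₀}` -/
  yc'_i₀ : yc D' i₀ = leftFaceDir h (r + k₀)
  /-- the mark of `D₁` is at the last contact end `Q = N_m` -/
  yc₁_i₀ : yc D₁ i₀ = leftFaceDir h (r + m)
  /-- the mark of `D₂` is at the first contact end `P = N_5` -/
  yc₂_i₀ : yc D₂ i₀ = leftFaceDir h (r + 5)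

namespace SlideData

variable {D' D₁ D₂ : TriMarkedDomain nm} {h : Site 2} {r m k₀ : Fin 6} {i₀ : Fin nm} (T : SlideData D' D₁ D₂ h r m k₀ i₀)
include T

/-! ### `Fin 6` bookkeeping -/

omit T in
/-- offsets in the outer run are not the offset `5` of `P`. [cite: BollobasRiordan2006, Ch. 7 §7.2.2 p. 168; lane plumbing] -/
private theorem ne_five_of_le {k m : Fin 6} (hk : k ≤ m) (hm : m.val ≤ 4) : k ≠ 5 := by
  revert hk hm; revert k m; decide

omit T in
/-- `k < m ≤ 4 ⇒ k + 1 ≤ m` (successor bookkeeping in the outer run). [cite: BollobasRiordan2006, Ch. 7 §7.2.2 p. 168; lane plumbing] -/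
private theorem add_one_le_of_lt {k m : Fin 6} (hk : k < m) (hm : m.val ≤ 4) : k + 1 ≤ m ∧ k < k + 1 ∧ (k + 1).val = k.val + 1 := by
  revert hk hm; revert k m; decide

omit T in
/-- `m ≤ 4 ⇒ m < 5`, and `m ≤ k ≠ 5 ⇒ m < k + 1` (the contact cells after the run). [cite: BollobasRiordan2006, Ch. 7 §7.2.2 p. 168; lane plumbing] -/
private theorem five_facts {k m : Fin 6} (hm : m.val ≤ 4) : m < 5 ∧ (m ≤ k → k ≠ 5 → m < k + 1) := by
  revert hm; revert k m; decide

/-! ### Sites, bonds and faces of the three domains -/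

/-- `h` is a site of `D'`. [cite: BollobasRiordan2006, Ch. 7 §7.2.2 p. 168] -/
theorem h_mem : h ∈ D'.verts := by rw [T.verts']; exact Finset.mem_insert_self _ _

/-- `G ⊆ G'`. [cite: BollobasRiordan2006, Ch. 7 §7.2.2 p. 168] -/
theorem verts₁_subset : D₁.verts ⊆ D'.verts := by rw [T.verts']; exact Finset.subset_insert _ _

/-- the bonds of `H_{G₂}` are those of `H_{G₁}`. [cite: KhristoforovSmirnov2021, §1.2 (arXiv v1 p. 2)] -/
theorem hBonds₂ : hBonds D₂ = hBonds D₁ := hBonds_eq_of_verts_eq' (D := D₁) T.verts₂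

/-- `H_G ⊆ H_{G'}`. [cite: KhristoforovSmirnov2021, §1.2 (arXiv v1 p. 2)] -/
theorem hBonds₁_subset : hBonds D₁ ⊆ hBonds D' := by
  intro b hb
  obtain ⟨u, w, rfl, hu, hadj⟩ := exists_rep_of_mem_hBonds D₁ hb
  exact mem_hBonds D' hadj (Or.inl (T.verts₁_subset hu))

omit T in
/-- every neighbour of `h` is at some offset from `r`. [cite: BollobasRiordan2006, Ch. 7 §7.2.2 p. 168; lane plumbing] -/
private theorem exists_offset_of_adj (r : Fin 6) {w : Site 2} (hadj : triGraph.Adj h w) : ∃ k : Fin 6, w = h + triDir (r + k) := by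
  obtain ⟨j, rfl⟩ := (triGraph_adj_iff_triDir h w).1 hadj
  exact ⟨j - r, by rw [add_sub_cancel]⟩

/-- ★ **`H_{G'} = H_G ⊔ {nb k : k ≤ m}`**: a bond of `H_{G'}` is a bond of `H_G` or one of the new bonds `{h, h + e_{r+k}}`, `k ≤ m`, of the outer path of `h`.
[cite: KhristoforovSmirnov2021, §1.2 (arXiv v1 p. 2: the edges of `H_Ω`); BollobasRiordan2006, Ch. 7 §7.2.2 p. 168] -/
theorem mem_hBonds'_iff {b : Sym2 (Site 2)} : b ∈ hBonds D' ↔ b ∈ hBonds D₁ ∨ ∃ k : Fin 6, k ≤ m ∧ b = nbond h (r + k) := by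
  constructor
  · intro hb
    obtain ⟨u, w, rfl, hu, hadj⟩ := exists_rep_of_mem_hBonds D' hb
    rw [T.verts', Finset.mem_insert] at hu
    rcases hu with rfl | hu
    · obtain ⟨k, rfl⟩ := exists_offset_of_adj r hadj
      by_cases hk : k ≤ m
      · exact Or.inr ⟨k, hk, rfl⟩
      · refine Or.inl ?_
        have hb₁ := mem_hBonds D₁ hadj.symm (Or.inl (T.inside k (not_le.1 hk)))
        rwa [Sym2.eq_swap] at hb₁
    · exact Or.inl (mem_hBonds D₁ hadj (Or.inl hu))
  · rintro (hb | ⟨k, -, rfl⟩)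
    · exact T.hBonds₁_subset hb
    · exact mem_hBonds D' (triGraph_adj_add_triDir h _) (Or.inl T.h_mem)

/-- the new bonds are bonds of `H_{G'}`. [cite: KhristoforovSmirnov2021, §1.2 (arXiv v1 p. 2)] -/
theorem nbond_mem_hBonds' (j : Fin 6) : nbond h j ∈ hBonds D' := mem_hBonds D' (triGraph_adj_add_triDir h _) (Or.inl T.h_mem)

/-- the new bonds are not bonds of `H_G` (both endpoints outside `G`). [cite: KhristoforovSmirnov2021, §1.2 (arXiv v1 p. 2)] -/
theorem nb_not_mem_hBonds₁ {k : Fin 6} (hk : k ≤ m) : nbond h (r + k) ∉ hBonds D₁ := by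
  intro hb
  obtain ⟨u, w, he, hu, -⟩ := exists_rep_of_mem_hBonds D₁ hb
  have hu' : u ∈ (nbond h (r + k) : Sym2 (Site 2)) := by rw [he]; exact Sym2.mem_mk_left u w
  rcases Sym2.mem_iff.1 hu' with rfl | rfl
  · exact T.not_mem hu
  · exact T.out k hk hu

/-- the outer side of `N_k`, `k < m`, is not a bond of `H_{G'}` (both endpoints outside `G'`). [cite: KhristoforovSmirnov2021, §1.2 (arXiv v1 p. 2)] -/
theorem outer_not_mem_hBonds' {k : Fin 6} (hk : k < m) : s(h + triDir (r + k), h + triDir (r + k + 1)) ∉ hBonds D' := by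
  intro hb
  obtain ⟨u, w, he, hu, -⟩ := exists_rep_of_mem_hBonds D' hb
  rw [T.verts', Finset.mem_insert] at hu
  have hu' : u ∈ (s(h + triDir (r + k), h + triDir (r + k + 1)) : Sym2 (Site 2)) := by rw [he]; exact Sym2.mem_mk_left u w
  have hk1 := (add_one_le_of_lt hk T.m_le).1
  rcases Sym2.mem_iff.1 hu' with rfl | rfl
  · rcases hu with e | hu
    · exact add_triDir_ne h _ e
    · exact T.out k hk.le hu
  · rcases hu with e | hu
    · exact add_triDir_ne h _ e
    · rw [add_assoc] at hu
      exact T.out (k + 1) hk1 hu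

/-- ★ the outer-path faces `N_k`, `k < m`, do NOT touch `G`. [cite: BollobasRiordan2006, Ch. 7 §7.2.2 p. 168] -/
theorem N_not_touching {k : Fin 6} (hk : k < m) : leftFaceDir h (r + k) ∉ triFacesTouching D₁.verts := by
  intro ht
  obtain ⟨u, hu, huF⟩ := mem_triFacesTouching.1 ht
  rw [RemovableAt.hexFaceVertices_leftFaceDir, Finset.mem_insert, Finset.mem_insert, Finset.mem_singleton] at huF
  have hk1 := (add_one_le_of_lt hk T.m_le).1
  rcases huF with rfl | rfl | rfl
  · exact T.not_mem hu
  · exact T.out k hk.le hu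
  · rw [add_assoc] at hu
    exact T.out (k + 1) hk1 hu

/-- every face `N_{r+k}` touches `G'`. [cite: BollobasRiordan2006, Ch. 7 §7.2.2 p. 168] -/
theorem N_touching' (k : Fin 6) : leftFaceDir h (r + k) ∈ triFacesTouching D'.verts :=
  mem_triFacesTouching.2 ⟨h, T.h_mem, by rw [RemovableAt.hexFaceVertices_leftFaceDir]; exact Finset.mem_insert_self _ _⟩

/-- the faces `N_k`, `m ≤ k`, touch `G` (they contain a contact cell). [cite: BollobasRiordan2006, Ch. 7 §7.2.2 p. 168] -/
theorem N_touching₁ {k : Fin 6} (hk : m ≤ k) : leftFaceDir h (r + k) ∈ triFacesTouching D₁.verts := by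
  rw [mem_triFacesTouching]
  by_cases e : k = 5
  · subst e
    exact ⟨h + triDir (r + 5), T.inside 5 ((five_facts (k := 5) T.m_le).1), by rw [RemovableAt.hexFaceVertices_leftFaceDir]; simp⟩
  · have hk1 : m < k + 1 := (five_facts T.m_le).2 hk e
    refine ⟨h + triDir (r + (k + 1)), T.inside (k + 1) hk1, ?_⟩
    rw [RemovableAt.hexFaceVertices_leftFaceDir, ← add_assoc]; simp

/-- ★ **the faces touching `G'`** are those touching `G` and the outer-path faces `N_k`, `k < m`. [cite: BollobasRiordan2006, Ch. 7 §7.2.2 p. 168] -/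
theorem mem_touching'_iff {F : HexVertex} : F ∈ triFacesTouching D'.verts ↔ F ∈ triFacesTouching D₁.verts ∨ ∃ k : Fin 6, k < m ∧ F = leftFaceDir h (r + k) := by
  constructor
  · intro hF
    obtain ⟨u, hu, huF⟩ := mem_triFacesTouching.1 hF
    rw [T.verts', Finset.mem_insert] at hu
    rcases hu with rfl | hu
    · obtain ⟨k, rfl⟩ := exists_eq_N_of_mem r huF
      by_cases hk : k < m
      · exact Or.inr ⟨k, hk, rfl⟩
      · exact Or.inl (T.N_touching₁ (not_lt.1 hk))
    · exact Or.inl (mem_triFacesTouching.2 ⟨u, hu, huF⟩)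
  · rintro (hF | ⟨k, -, rfl⟩)
    · obtain ⟨u, hu, huF⟩ := mem_triFacesTouching.1 hF
      exact mem_triFacesTouching.2 ⟨u, T.verts₁_subset hu, huF⟩
    · exact T.N_touching' k

/-! ### Corner faces -/

/-- `P ≠ Q`, `a ≠ Q`, `a ≠ P`. [cite: BollobasRiordan2006, Ch. 7 §7.2.2 p. 169; lane plumbing] -/
theorem PQa_ne : leftFaceDir h (r + 5) ≠ leftFaceDir h (r + m) ∧ leftFaceDir h (r + k₀) ≠ leftFaceDir h (r + m) ∧
    leftFaceDir h (r + k₀) ≠ leftFaceDir h (r + 5) := by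
  refine ⟨fun e => ?_, fun e => ?_, fun e => ?_⟩
  · exact ne_five_of_le le_rfl T.m_le (N_inj e).symm
  · exact T.k₀_lt.ne (N_inj e)
  · exact ne_five_of_le T.k₀_lt.le T.m_le (N_inj e)

/-- the corner faces of `D₁` other than `Q` are not `P` (they are corner faces of `D₂`, whose `i₀`-th is `P`). [cite: BollobasRiordan2006, Ch. 7 §7.2.2 p. 169] -/
theorem yc₁_ne_P {i : Fin nm} (hi : i ≠ i₀) : yc D₁ i ≠ leftFaceDir h (r + 5) := by
  rw [← T.yc₂ i hi, ← T.yc₂_i₀]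
  exact fun e => hi (yc_injective D₂ e)

/-- … nor `Q`. [cite: BollobasRiordan2006, Ch. 7 §7.2.2 p. 169] -/
theorem yc₁_ne_Q {i : Fin nm} (hi : i ≠ i₀) : yc D₁ i ≠ leftFaceDir h (r + m) := by
  rw [← T.yc₁_i₀]
  exact fun e => hi (yc_injective D₁ e)

/-- … nor an outer-path face (corner faces touch `G`). [cite: BollobasRiordan2006, Ch. 7 §7.2.2 p. 169] -/
theorem yc₁_ne_N (i : Fin nm) {k : Fin 6} (hk : k < m) : yc D₁ i ≠ leftFaceDir h (r + k) :=
  fun e => T.N_not_touching hk (e ▸ yc_mem_touching D₁ i)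

/-- ★ **corner faces off the hexagon agree**: a face touching `G` other than `P` and `Q` is a corner face of `D'` iff of `D₁` iff of `D₂`.
[cite: BollobasRiordan2006, Ch. 7 §7.2.2 p. 169; KhristoforovSmirnov2021, §1.2 (arXiv v1 p. 2)] -/
theorem mem_corners'_iff {F : HexVertex} (hF : F ∈ triFacesTouching D₁.verts) (hP : F ≠ leftFaceDir h (r + 5)) (hQ : F ≠ leftFaceDir h (r + m)) :
    (F ∈ corners D' ↔ F ∈ corners D₁) ∧ (F ∈ corners D₂ ↔ F ∈ corners D₁) := by
  rw [mem_corners, mem_corners, mem_corners]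
  refine ⟨⟨?_, ?_⟩, ⟨?_, ?_⟩⟩
  · rintro ⟨i, rfl⟩
    by_cases hi : i = i₀
    · subst hi; exact absurd (T.yc'_i₀ ▸ hF) (T.N_not_touching T.k₀_lt)
    · exact ⟨i, T.yc' i hi⟩
  · rintro ⟨i, rfl⟩
    by_cases hi : i = i₀
    · subst hi; exact absurd T.yc₁_i₀ hQ
    · exact ⟨i, (T.yc' i hi).symm⟩
  · rintro ⟨i, rfl⟩
    by_cases hi : i = i₀
    · subst hi; exact absurd T.yc₂_i₀ hP
    · exact ⟨i, T.yc₂ i hi⟩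
  · rintro ⟨i, rfl⟩
    by_cases hi : i = i₀
    · subst hi; exact absurd T.yc₁_i₀ hQ
    · exact ⟨i, (T.yc₂ i hi).symm⟩

/-- `Q ∈ corners D₁`, `Q ∉ corners D'`, `Q ∉ corners D₂`. [cite: BollobasRiordan2006, Ch. 7 §7.2.2 p. 169] -/
theorem Q_corners : leftFaceDir h (r + m) ∈ corners D₁ ∧ leftFaceDir h (r + m) ∉ corners D' ∧ leftFaceDir h (r + m) ∉ corners D₂ := by
  refine ⟨(mem_corners D₁).2 ⟨i₀, T.yc₁_i₀.symm⟩, fun hc => ?_, fun hc => ?_⟩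
  · obtain ⟨i, hi⟩ := (mem_corners D').1 hc
    by_cases e : i = i₀
    · subst e; exact T.PQa_ne.2.1 (hi.trans T.yc'_i₀).symm
    · exact T.yc₁_ne_Q e (hi.trans (T.yc' i e)).symm
  · obtain ⟨i, hi⟩ := (mem_corners D₂).1 hc
    by_cases e : i = i₀
    · subst e; exact T.PQa_ne.1 (hi.trans T.yc₂_i₀).symm
    · exact T.yc₁_ne_Q e (hi.trans (T.yc₂ i e)).symm

/-- `P ∈ corners D₂`, `P ∉ corners D'`, `P ∉ corners D₁`. [cite: BollobasRiordan2006, Ch. 7 §7.2.2 p. 169] -/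
theorem P_corners : leftFaceDir h (r + 5) ∈ corners D₂ ∧ leftFaceDir h (r + 5) ∉ corners D' ∧ leftFaceDir h (r + 5) ∉ corners D₁ := by
  refine ⟨(mem_corners D₂).2 ⟨i₀, T.yc₂_i₀.symm⟩, fun hc => ?_, fun hc => ?_⟩
  · obtain ⟨i, hi⟩ := (mem_corners D').1 hc
    by_cases e : i = i₀
    · subst e; exact T.PQa_ne.2.2 (hi.trans T.yc'_i₀).symm
    · exact T.yc₁_ne_P e (hi.trans (T.yc' i e)).symm
  · obtain ⟨i, hi⟩ := (mem_corners D₁).1 hc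
    by_cases e : i = i₀
    · subst e; exact T.PQa_ne.1 (hi.trans T.yc₁_i₀)
    · exact T.yc₁_ne_P e hi.symm

/-- an outer-path face `N_k`, `k < m`, is a corner face of `D'` iff `k = k₀`; it is never a corner face of `D₁` or `D₂`. [cite: BollobasRiordan2006, Ch. 7 §7.2.2 p. 169] -/
theorem N_corners {k : Fin 6} (hk : k < m) :
    (leftFaceDir h (r + k) ∈ corners D' ↔ k = k₀) ∧ leftFaceDir h (r + k) ∉ corners D₁ ∧ leftFaceDir h (r + k) ∉ corners D₂ := by
  refine ⟨⟨fun hc => ?_, fun e => ?_⟩, fun hc => ?_, fun hc => ?_⟩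
  · obtain ⟨i, hi⟩ := (mem_corners D').1 hc
    by_cases e : i = i₀
    · subst e; exact N_inj (hi.trans T.yc'_i₀)
    · exact absurd (hi.trans (T.yc' i e)).symm (T.yc₁_ne_N i hk)
  · subst e; exact (mem_corners D').2 ⟨i₀, T.yc'_i₀.symm⟩
  · obtain ⟨i, hi⟩ := (mem_corners D₁).1 hc
    exact T.yc₁_ne_N i hk hi.symm
  · obtain ⟨i, hi⟩ := (mem_corners D₂).1 hc
    by_cases e : i = i₀
    · subst e; exact ne_five_of_le hk.le T.m_le (N_inj (hi.trans T.yc₂_i₀))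
    · exact T.yc₁_ne_N i hk (hi.trans (T.yc₂ i e)).symm

/-! ### The two halves of the outer path -/

/-- **the bonds of the outer path strictly after `a`**: `nb k`, `k₀ < k ≤ m` (the path `a — ⋯ — Q`). [cite: KhristoforovSmirnov2021, §1.2 (arXiv v1 p. 2); lane tool notion] -/
def EQ (h : Site 2) (r m k₀ : Fin 6) : Finset (Sym2 (Site 2)) :=
  ((Finset.univ : Finset (Fin 6)).filter fun k => k₀ < k ∧ k ≤ m).image fun k => nbond h (r + k)

/-- **the bonds of the outer path up to `a`**: `nb k`, `k ≤ k₀` (the path `P — N_0 — ⋯ — a`). [cite: KhristoforovSmirnov2021, §1.2 (arXiv v1 p. 2); lane tool notion] -/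
def EP (h : Site 2) (r k₀ : Fin 6) : Finset (Sym2 (Site 2)) :=
  ((Finset.univ : Finset (Fin 6)).filter fun k => k ≤ k₀).image fun k => nbond h (r + k)

omit T in
/-- membership in `EQ`. [cite: KhristoforovSmirnov2021, §1.2 (arXiv v1 p. 2); lane plumbing] -/
theorem mem_EQ_iff {b : Sym2 (Site 2)} : b ∈ EQ h r m k₀ ↔ ∃ k : Fin 6, (k₀ < k ∧ k ≤ m) ∧ b = nbond h (r + k) := by
  unfold EQ
  simp only [Finset.mem_image, Finset.mem_filter, Finset.mem_univ, true_and]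
  exact ⟨fun ⟨k, hk, e⟩ => ⟨k, hk, e.symm⟩, fun ⟨k, hk, e⟩ => ⟨k, hk, e.symm⟩⟩

omit T in
/-- membership in `EP`. [cite: KhristoforovSmirnov2021, §1.2 (arXiv v1 p. 2); lane plumbing] -/
theorem mem_EP_iff {b : Sym2 (Site 2)} : b ∈ EP h r k₀ ↔ ∃ k : Fin 6, k ≤ k₀ ∧ b = nbond h (r + k) := by
  unfold EP
  simp only [Finset.mem_image, Finset.mem_filter, Finset.mem_univ, true_and]
  exact ⟨fun ⟨k, hk, e⟩ => ⟨k, hk, e.symm⟩, fun ⟨k, hk, e⟩ => ⟨k, hk, e.symm⟩⟩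

omit T in
/-- `nb k ∈ EQ ↔ k₀ < k ≤ m`. [cite: KhristoforovSmirnov2021, §1.2 (arXiv v1 p. 2); lane plumbing] -/
theorem nbond_mem_EQ_iff (k : Fin 6) : nbond h (r + k) ∈ EQ h r m k₀ ↔ k₀ < k ∧ k ≤ m := by
  rw [mem_EQ_iff]
  constructor
  · rintro ⟨k', hk', e⟩
    rw [add_left_cancel (nbond_inj e)]; exact hk'
  · exact fun hk => ⟨k, hk, rfl⟩

omit T in
/-- `nb k ∈ EP ↔ k ≤ k₀`. [cite: KhristoforovSmirnov2021, §1.2 (arXiv v1 p. 2); lane plumbing] -/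
theorem nbond_mem_EP_iff (k : Fin 6) : nbond h (r + k) ∈ EP h r k₀ ↔ k ≤ k₀ := by
  rw [mem_EP_iff]
  constructor
  · rintro ⟨k', hk', e⟩
    rw [add_left_cancel (nbond_inj e)]; exact hk'
  · exact fun hk => ⟨k, hk, rfl⟩

/-- **one half of the outer path as a pendant attachment with root `R = N_{kR}`** (`kR = m`: the half ending at `Q`; `kR = 5`: the half starting at `P`), for the small
domain `Dc` (`D₁`, resp. `D₂`) whose `i₀`-th corner face is `R`: the bonds are new bonds, their faces are outer-path faces or `R`, their side counts are odd exactly at `a`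
and `R`, and they join `a` to `R`. [cite: KhristoforovSmirnov2021, §1.2 (arXiv v1 p. 2: `IP(ξ)` is a union of disjoint paths); BollobasRiordan2006, Ch. 7 §7.2.2 pp. 168–169] -/
structure CaseData (D₁ Dc : TriMarkedDomain nm) (h : Site 2) (r m k₀ : Fin 6) (i₀ : Fin nm) (E : Finset (Sym2 (Site 2))) (kR : Fin 6) : Prop where
  /-- same sites -/
  verts : Dc.verts = D₁.verts
  /-- same corner faces off `i₀` -/
  ycc : ∀ i, i ≠ i₀ → yc Dc i = yc D₁ i
  /-- the `i₀`-th corner face is the root -/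
  ycc_i₀ : yc Dc i₀ = leftFaceDir h (r + kR)
  /-- the root is `Q` or `P` -/
  kR_eq : kR = m ∨ kR = 5
  /-- the bonds are new bonds -/
  sub : ∀ b ∈ E, ∃ k : Fin 6, k ≤ m ∧ b = nbond h (r + k)
  /-- their faces are outer-path faces or the root -/
  faces : ∀ b ∈ E, ∀ F : HexVertex, Inc F b → (∃ k : Fin 6, k < m ∧ F = leftFaceDir h (r + k)) ∨ F = leftFaceDir h (r + kR)
  /-- their side counts around `h` are odd exactly at `a` and at the root -/
  parity : ∀ k : Fin 6, Odd (xiDeg E (leftFaceDir h (r + k))) ↔ (k = k₀ ∨ k = kR)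
  /-- they join `a` to the root -/
  conn : (sideGraph E).Reachable (leftFaceDir h (r + k₀)) (leftFaceDir h (r + kR))

/-! ### The two cases are case data -/

omit T in
/-- `Fin 6` facts for the half ending at `Q`. [cite: BollobasRiordan2006, Ch. 7 §7.2.2 p. 168; lane plumbing] -/
private theorem finQ (k m k₀ : Fin 6) (hm : m.val ≤ 4) (h0 : k₀ < m) :
    (k₀ < k → k ≤ m → (k < m ∨ k = m) ∧ k + 5 < m) ∧ (¬ ((k₀ < k + 1 ∧ k + 1 ≤ m) ↔ (k₀ < k ∧ k ≤ m)) ↔ (k = k₀ ∨ k = m)) := by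
  revert hm h0; revert k m k₀; decide

omit T in
/-- `Fin 6` facts for the half starting at `P`. [cite: BollobasRiordan2006, Ch. 7 §7.2.2 p. 168; lane plumbing] -/
private theorem finP (k m k₀ : Fin 6) (hm : m.val ≤ 4) (h0 : k₀ < m) :
    (k ≤ k₀ → k < m ∧ (k + 5 < m ∨ k + 5 = 5)) ∧ (¬ ((k + 1 ≤ k₀) ↔ (k ≤ k₀)) ↔ (k = k₀ ∨ k = 5)) := by
  revert hm h0; revert k m k₀; decide

omit T in
/-- `Fin 6` successor / predecessor facts. [cite: BollobasRiordan2006, Ch. 7 §7.2.2 p. 168; lane plumbing] -/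
private theorem fin_pred {k : Fin 6} (hk : 1 ≤ k.val) : (k + 5).val = k.val - 1 ∧ k + 5 + 1 = k := by
  revert hk; revert k; decide

omit T in
/-- `k + 1 + 5 = k` in `Fin 6`. [cite: BollobasRiordan2006, Ch. 7 §7.2.2 p. 168; lane plumbing] -/
private theorem add_one_add_five (k : Fin 6) : k + 1 + 5 = k := by
  revert k; decide

omit T in
/-- the side count of a set of `nbond h`'s at the face `N_j`: odd iff exactly one of `nb (j+1)`, `nb j` is present. [cite: KhristoforovSmirnov2021, §1.2 (arXiv v1 p. 2)] -/
theorem odd_xiDeg_N_iff {E : Finset (Sym2 (Site 2))} (hE : ∀ b ∈ E, ∃ l : Fin 6, b = nbond h l) (j : Fin 6) :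
    Odd (xiDeg E (leftFaceDir h j)) ↔ ¬ (nbond h (j + 1) ∈ E ↔ nbond h j ∈ E) := by
  have ha : side (leftFaceDir h j) (leftFaceIdx j) ∉ E := by
    intro hm
    obtain ⟨l, hl⟩ := hE _ hm
    rw [side_N_idx] at hl
    exact outer_ne_nbond h j (j + 1) l hl
  rw [odd_xiDeg_iff_not_iff (leftFaceIdx j) ha, side_N_idx_add_one, side_N_idx_add_two]

omit T in
/-- two consecutive faces around `h` are adjacent in the side graph of a set containing the bond between them. [cite: KhristoforovSmirnov2021, §1.2 (arXiv v1 p. 2)] -/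
theorem adj_N_succ {E : Finset (Sym2 (Site 2))} (j : Fin 6) (hb : nbond h (j + 1) ∈ E) : (sideGraph E).Adj (leftFaceDir h j) (leftFaceDir h (j + 1)) :=
  ⟨leftFaceIdx j + 1, (oppFace_leftFaceDir_next h j).symm, by rw [side_N_idx_add_one]; exact hb⟩

omit T in
/-- … and so are `N_j`, `N_{j+5}` across `nb j`. [cite: KhristoforovSmirnov2021, §1.2 (arXiv v1 p. 2)] -/
theorem adj_N_pred {E : Finset (Sym2 (Site 2))} (j : Fin 6) (hb : nbond h j ∈ E) : (sideGraph E).Adj (leftFaceDir h j) (leftFaceDir h (j + 5)) :=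
  ⟨leftFaceIdx j + 2, (oppFace_leftFaceDir_right h j).symm, by rw [side_N_idx_add_two]; exact hb⟩

/-- ★ **the half ending at `Q` is case data for `D₁`.** [cite: KhristoforovSmirnov2021, §1.2 (arXiv v1 p. 2); BollobasRiordan2006, Ch. 7 §7.2.2 pp. 168–169] -/
theorem caseQ : CaseData D₁ D₁ h r m k₀ i₀ (EQ h r m k₀) m where
  verts := rfl
  ycc := fun _ _ => rfl
  ycc_i₀ := T.yc₁_i₀
  kR_eq := Or.inl rfl
  sub := fun b hb => by
    obtain ⟨k, hk, e⟩ := mem_EQ_iff.1 hb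
    exact ⟨k, hk.2, e⟩
  faces := fun b hb F hF => by
    obtain ⟨k, hk, rfl⟩ := mem_EQ_iff.1 hb
    have hf := (finQ k m k₀ T.m_le T.k₀_lt).1 hk.1 hk.2
    rcases eq_N_or_of_inc (r + k) hF with rfl | rfl
    · rcases hf.1 with h1 | rfl
      · exact Or.inl ⟨k, h1, rfl⟩
      · exact Or.inr rfl
    · rw [add_assoc]
      exact Or.inl ⟨k + 5, hf.2, rfl⟩
  parity := fun k => by
    rw [odd_xiDeg_N_iff (fun b hb => by obtain ⟨l, -, e⟩ := mem_EQ_iff.1 hb; exact ⟨r + l, e⟩), add_assoc, nbond_mem_EQ_iff, nbond_mem_EQ_iff]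
    exact (finQ k m k₀ T.m_le T.k₀_lt).2
  conn := by
    -- walk `a = N_{k₀} — N_{k₀+1} — ⋯ — N_m` along `nb (k₀+1), …, nb m`
    suffices H : ∀ n : ℕ, ∀ k : Fin 6, k.val = k₀.val + n → k ≤ m →
        (sideGraph (EQ h r m k₀)).Reachable (leftFaceDir h (r + k₀)) (leftFaceDir h (r + k)) from
      H (m.val - k₀.val) m (by have := T.k₀_lt; rw [Fin.lt_def] at this; omega) le_rfl
    intro n
    induction n with
    | zero =>
      intro k hk _
      rw [show k = k₀ from Fin.ext (by omega)]
    | succ n ih =>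
      intro k hk hkm
      have hk1 : 1 ≤ k.val := by omega
      obtain ⟨hv, hs⟩ := fin_pred hk1
      have h' := ih (k + 5) (by rw [hv]; omega) (by rw [Fin.le_def, hv]; rw [Fin.le_def] at hkm; omega)
      refine h'.trans (SimpleGraph.Adj.reachable ?_)
      have hadj := adj_N_succ (E := EQ h r m k₀) (r + (k + 5)) (by
        rw [add_assoc, hs, nbond_mem_EQ_iff]
        exact ⟨by rw [Fin.lt_def]; omega, hkm⟩)
      rwa [add_assoc, hs] at hadj

/-- ★ **the half starting at `P` is case data for `D₂`.** [cite: KhristoforovSmirnov2021, §1.2 (arXiv v1 p. 2); BollobasRiordan2006, Ch. 7 §7.2.2 pp. 168–169] -/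
theorem caseP : CaseData D₁ D₂ h r m k₀ i₀ (EP h r k₀) 5 where
  verts := T.verts₂
  ycc := T.yc₂
  ycc_i₀ := T.yc₂_i₀
  kR_eq := Or.inr rfl
  sub := fun b hb => by
    obtain ⟨k, hk, e⟩ := mem_EP_iff.1 hb
    exact ⟨k, hk.trans T.k₀_lt.le, e⟩
  faces := fun b hb F hF => by
    obtain ⟨k, hk, rfl⟩ := mem_EP_iff.1 hb
    have hf := (finP k m k₀ T.m_le T.k₀_lt).1 hk
    rcases eq_N_or_of_inc (r + k) hF with rfl | rfl
    · exact Or.inl ⟨k, hf.1, rfl⟩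
    · rw [add_assoc]
      rcases hf.2 with h1 | h1
      · exact Or.inl ⟨k + 5, h1, rfl⟩
      · rw [h1]; exact Or.inr rfl
  parity := fun k => by
    rw [odd_xiDeg_N_iff (fun b hb => by obtain ⟨l, -, e⟩ := mem_EP_iff.1 hb; exact ⟨r + l, e⟩), add_assoc, nbond_mem_EP_iff, nbond_mem_EP_iff]
    exact (finP k m k₀ T.m_le T.k₀_lt).2
  conn := by
    -- walk `a = N_{k₀} — N_{k₀-1} — ⋯ — N_0 — N_5 = P` along `nb k₀, …, nb 0`
    have H : ∀ n : ℕ, ∀ k : Fin 6, k.val + n = k₀.val →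
        (sideGraph (EP h r k₀)).Reachable (leftFaceDir h (r + k₀)) (leftFaceDir h (r + k)) := by
      intro n
      induction n with
      | zero =>
        intro k hk
        rw [show k = k₀ from Fin.ext (by omega)]
      | succ n ih =>
        intro k hk
        have hk4 : k.val < 5 := by have := T.m_le; have h0 := T.k₀_lt; rw [Fin.lt_def] at h0; omega
        have hv : (k + 1).val = k.val + 1 := fin6_val_add_one hk4
        have h' := ih (k + 1) (by rw [hv]; omega)
        refine h'.trans (SimpleGraph.Adj.reachable ?_)
        have hadj := adj_N_pred (E := EP h r k₀) (r + (k + 1)) (by rw [nbond_mem_EP_iff, Fin.le_def, hv]; omega)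
        rwa [add_assoc, add_one_add_five] at hadj
    have h0 := H k₀.val 0 (by simp)
    refine h0.trans (SimpleGraph.Adj.reachable ?_)
    have hadj := adj_N_pred (E := EP h r k₀) (r + 0) (by rw [nbond_mem_EP_iff]; exact Fin.zero_le _)
    rwa [add_assoc, zero_add] at hadj

/-! ### The core: deleting / adding one half of the outer path -/

section Core

variable {Dc : TriMarkedDomain nm} {E : Finset (Sym2 (Site 2))} {kR : Fin 6} (C : CaseData D₁ Dc h r m k₀ i₀ E kR)
include C

/-- the root touches `G`. [cite: BollobasRiordan2006, Ch. 7 §7.2.2 p. 168] -/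
theorem R_touching : leftFaceDir h (r + kR) ∈ triFacesTouching D₁.verts := by
  rcases C.kR_eq with rfl | rfl
  · exact T.N_touching₁ le_rfl
  · exact T.N_touching₁ (by have := T.m_le; rw [Fin.le_def]; simp; omega)

/-- the root is not a corner face of `D'`, and the other corner faces of `D₁` are not the root. [cite: BollobasRiordan2006, Ch. 7 §7.2.2 p. 169] -/
theorem R_not_corner' : leftFaceDir h (r + kR) ∉ corners D' ∧ ∀ i, i ≠ i₀ → yc D₁ i ≠ leftFaceDir h (r + kR) := by
  rcases C.kR_eq with rfl | rfl
  · exact ⟨T.Q_corners.2.1, fun i hi => T.yc₁_ne_Q hi⟩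
  · exact ⟨T.P_corners.2.1, fun i hi => T.yc₁_ne_P hi⟩

/-- `E` avoids `H_G`. [cite: KhristoforovSmirnov2021, §1.2 (arXiv v1 p. 2)] -/
theorem disjoint_of_subset {ξ : Finset (Sym2 (Site 2))} (hξ : ξ ⊆ hBonds D₁) : Disjoint ξ E := by
  rw [Finset.disjoint_left]
  intro b hb hbE
  obtain ⟨k, hk, rfl⟩ := C.sub b hbE
  exact T.nb_not_mem_hBonds₁ hk (hξ hb)

/-- `E ⊆ H_{G'}`. [cite: KhristoforovSmirnov2021, §1.2 (arXiv v1 p. 2)] -/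
theorem E_subset' : E ⊆ hBonds D' := by
  intro b hb
  obtain ⟨k, -, rfl⟩ := C.sub b hb
  exact T.nbond_mem_hBonds' _

/-- the pendant hypotheses of §1 for `E` over `H_G`, with `S` the outer-path faces and root `R`. [cite: KhristoforovSmirnov2021, §1.2 (arXiv v1 p. 2)] -/
theorem pendant {ξ : Finset (Sym2 (Site 2))} (hξ : ξ ⊆ hBonds D₁) :
    (∀ F ∈ ((Finset.univ : Finset (Fin 6)).filter fun k => k < m).image (fun k => leftFaceDir h (r + k)), ∀ j : Fin 3, side F j ∈ ξ ∪ E → side F j ∈ E) ∧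
    (∀ F, F ∉ ((Finset.univ : Finset (Fin 6)).filter fun k => k < m).image (fun k => leftFaceDir h (r + k)) → F ≠ leftFaceDir h (r + kR) →
      ∀ j : Fin 3, side F j ∉ E) := by
  constructor
  · intro F hF j hj
    obtain ⟨k, hk, rfl⟩ := Finset.mem_image.1 hF
    have hk' : k < m := (Finset.mem_filter.1 hk).2
    rcases Finset.mem_union.1 hj with h1 | h1
    · exact absurd (mem_touching_of_side_mem D₁ (hξ h1)) (T.N_not_touching hk')
    · exact h1
  · intro F hF hR j hj
    rcases C.faces _ hj F (inc_side F j) with ⟨k, hk, rfl⟩ | e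
    · exact hF (Finset.mem_image.2 ⟨k, Finset.mem_filter.2 ⟨Finset.mem_univ _, hk⟩, rfl⟩)
    · exact hR e

omit C in
/-- a face touching `G` is not an outer-path face. [cite: BollobasRiordan2006, Ch. 7 §7.2.2 p. 168] -/
theorem not_mem_S_of_touching {F : HexVertex} (hF : F ∈ triFacesTouching D₁.verts) :
    F ∉ ((Finset.univ : Finset (Fin 6)).filter fun k => k < m).image (fun k => leftFaceDir h (r + k)) := by
  intro h1
  obtain ⟨k, hk, rfl⟩ := Finset.mem_image.1 h1
  exact T.N_not_touching (Finset.mem_filter.1 hk).2 hF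

/-- ★ **links off the hexagon are unchanged** by adding `E`. [cite: KhristoforovSmirnov2021, §1.2 (arXiv v1 p. 2: `IP(ξ)` is a union of disjoint paths)] -/
theorem reachable_union_iff {ξ : Finset (Sym2 (Site 2))} (hξ : ξ ⊆ hBonds D₁) {X Y : HexVertex} (hX : X ∈ triFacesTouching D₁.verts)
    (hY : Y ∈ triFacesTouching D₁.verts) : (sideGraph (ξ ∪ E)).Reachable X Y ↔ (sideGraph ξ).Reachable X Y :=
  reachable_union_pendant (T.pendant C hξ).1 (T.pendant C hξ).2 (T.disjoint_of_subset C hξ) (T.not_mem_S_of_touching hX) (T.not_mem_S_of_touching hY)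

/-- ★ **the slid mark is linked to what the root was linked to.** [cite: KhristoforovSmirnov2021, §1.2 (arXiv v1 p. 2: `IP(ξ)` is a union of disjoint paths)] -/
theorem reachable_a_union_iff {ξ : Finset (Sym2 (Site 2))} (hξ : ξ ⊆ hBonds D₁) {Y : HexVertex} (hY : Y ∈ triFacesTouching D₁.verts) :
    (sideGraph (ξ ∪ E)).Reachable (leftFaceDir h (r + k₀)) Y ↔ (sideGraph ξ).Reachable (leftFaceDir h (r + kR)) Y :=
  reachable_union_pendant_root (T.pendant C hξ).1 (T.pendant C hξ).2 (T.disjoint_of_subset C hξ)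
    (Finset.mem_image.2 ⟨k₀, Finset.mem_filter.2 ⟨Finset.mem_univ _, T.k₀_lt⟩, rfl⟩) (T.not_mem_S_of_touching hY) C.conn

/-- the side count of `E` at a face touching `G` is odd iff the face is the root. [cite: KhristoforovSmirnov2021, §1.2 (arXiv v1 p. 2)] -/
theorem odd_xiDeg_E_iff {F : HexVertex} (hF : F ∈ triFacesTouching D₁.verts) : Odd (xiDeg E F) ↔ F = leftFaceDir h (r + kR) := by
  by_cases hh : h ∈ hexFaceVertices F
  · obtain ⟨k, rfl⟩ := exists_eq_N_of_mem r hh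
    rw [C.parity k]
    constructor
    · rintro (rfl | rfl)
      · exact absurd hF (T.N_not_touching T.k₀_lt)
      · rfl
    · exact fun e => Or.inr (N_inj e)
  · have h0 : xiDeg E F = 0 := by
      rw [l1_xiDeg_eq, Finset.card_eq_zero, Finset.filter_eq_empty_iff]
      intro j _ hj
      obtain ⟨k, -, e⟩ := C.sub _ hj
      exact side_ne_nbond_of_not_mem hh j _ e
    rw [h0]
    constructor
    · intro h1; exact absurd h1 (by decide)
    · intro e; rw [e, RemovableAt.hexFaceVertices_leftFaceDir] at hh; exact absurd (Finset.mem_insert_self _ _) hh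

/-- corner faces of `Dc` among the faces touching `G`: those of `D₁` off `i₀`, or the root. [cite: BollobasRiordan2006, Ch. 7 §7.2.2 p. 169] -/
theorem mem_corners_c_iff (F : HexVertex) : F ∈ corners Dc ↔ (∃ i, i ≠ i₀ ∧ F = yc D₁ i) ∨ F = leftFaceDir h (r + kR) := by
  rw [mem_corners]
  constructor
  · rintro ⟨i, rfl⟩
    by_cases hi : i = i₀
    · subst hi; exact Or.inr C.ycc_i₀
    · exact Or.inl ⟨i, hi, C.ycc i hi⟩
  · rintro (⟨i, hi, rfl⟩ | rfl)
    · exact ⟨i, (C.ycc i hi).symm⟩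
    · exact ⟨i₀, C.ycc_i₀.symm⟩

/-- corner faces of `D'` among the faces touching `G`: those of `D₁` off `i₀`. [cite: BollobasRiordan2006, Ch. 7 §7.2.2 p. 169] -/
theorem mem_corners'_iff_of_touching {F : HexVertex} (hF : F ∈ triFacesTouching D₁.verts) : F ∈ corners D' ↔ ∃ i, i ≠ i₀ ∧ F = yc D₁ i := by
  rw [mem_corners]
  constructor
  · rintro ⟨i, rfl⟩
    by_cases hi : i = i₀
    · subst hi; exact absurd (T.yc'_i₀ ▸ hF) (T.N_not_touching T.k₀_lt)
    · exact ⟨i, hi, T.yc' i hi⟩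
  · rintro ⟨i, hi, rfl⟩
    exact ⟨i, (T.yc' i hi).symm⟩

omit T C in
/-- propositional bookkeeping at the root. [cite: KhristoforovSmirnov2021, §1.2 (arXiv v1 p. 2); lane plumbing] -/
private theorem prop_root (O S : Prop) : ((O ↔ ¬True) ↔ (False ∧ ¬S ∨ S ∧ ¬False)) ↔ (O ↔ (True ∧ ¬S ∨ S ∧ ¬True)) := by tauto

omit T C in
/-- propositional bookkeeping off the root. [cite: KhristoforovSmirnov2021, §1.2 (arXiv v1 p. 2); lane plumbing] -/
private theorem prop_off_root (O A S : Prop) : ((O ↔ ¬False) ↔ (A ∧ ¬S ∨ S ∧ ¬A)) ↔ (O ↔ (A ∧ ¬S ∨ S ∧ ¬A)) := by tauto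

/-- ★★ **THE PARITY PROFILES CORRESPOND**: for `ξ ⊆ H_G` and an odd face `s` touching `G`, `ξ ∪ E` has odd faces «corners of `D'` XOR `s`» over the faces touching `G'` iff `ξ` has
odd faces «corners of `Dc` XOR `s`» over the faces touching `G`. [cite: KhristoforovSmirnov2021, §1.2 (arXiv v1 pp. 2–3: loop configurations with prescribed disorders)] -/
theorem parityIs_union_iff {ξ : Finset (Sym2 (Site 2))} (hξ : ξ ⊆ hBonds D₁) {s : HexVertex} (hs : s ∈ triFacesTouching D₁.verts) :
    ParityIs D' (ξ ∪ E) (symmDiff (corners D') {s}) ↔ ParityIs Dc ξ (symmDiff (corners Dc) {s}) := by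
  have hdisj := T.disjoint_of_subset C hξ
  have hRC : ¬ ∃ i, i ≠ i₀ ∧ leftFaceDir h (r + kR) = yc D₁ i := fun ⟨i, hi, e⟩ => (T.R_not_corner' C).2 i hi e.symm
  -- the profile at a face touching `G`
  have key : ∀ F ∈ triFacesTouching D₁.verts,
      ((Odd (xiDeg (ξ ∪ E) F) ↔ F ∈ symmDiff (corners D') {s}) ↔ (Odd (xiDeg ξ F) ↔ F ∈ symmDiff (corners Dc) {s})) := by
    intro F hF
    rw [xiDeg_union_of_disjoint hdisj, Nat.odd_add, ← Nat.not_odd_iff_even, T.odd_xiDeg_E_iff C hF, Finset.mem_symmDiff, Finset.mem_symmDiff,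
      Finset.mem_singleton, T.mem_corners'_iff_of_touching C hF, T.mem_corners_c_iff C F]
    by_cases hR : F = leftFaceDir h (r + kR)
    · have h1 : ¬ ∃ i, i ≠ i₀ ∧ F = yc D₁ i := by rw [hR]; exact hRC
      have e1 : ((∃ i, i ≠ i₀ ∧ F = yc D₁ i) ∨ F = leftFaceDir h (r + kR)) ↔ True := ⟨fun _ => trivial, fun _ => Or.inr hR⟩
      rw [e1, iff_false_intro h1, iff_true_intro hR]
      exact prop_root _ _
    · have e1 : ((∃ i, i ≠ i₀ ∧ F = yc D₁ i) ∨ F = leftFaceDir h (r + kR)) ↔ (∃ i, i ≠ i₀ ∧ F = yc D₁ i) := ⟨fun h' => h'.resolve_right hR, Or.inl⟩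
      rw [e1, iff_false_intro hR]
      exact prop_off_root _ _ _
  unfold ParityIs
  rw [C.verts]
  constructor
  · intro hP F hF
    exact (key F hF).1 (hP F ((T.mem_touching'_iff).2 (Or.inl hF)))
  · intro hP F hF
    rcases (T.mem_touching'_iff).1 hF with hF₁ | ⟨k, hk, rfl⟩
    · exact (key F hF₁).2 (hP F hF₁)
    · -- an outer-path face: no `ξ`-side, and the `E`-profile is automatic
      have h0 : xiDeg ξ (leftFaceDir h (r + k)) = 0 := by
        rw [l1_xiDeg_eq, Finset.card_eq_zero, Finset.filter_eq_empty_iff]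
        intro j _ hj
        exact T.N_not_touching hk (mem_touching_of_side_mem D₁ (hξ hj))
      rw [xiDeg_union_of_disjoint hdisj, h0, zero_add, C.parity k, Finset.mem_symmDiff, Finset.mem_singleton, (T.N_corners hk).1]
      have hks : leftFaceDir h (r + k) ≠ s := fun e => T.N_not_touching hk (e ▸ hs)
      have hkR : k ≠ kR := by
        rintro rfl
        exact T.N_not_touching hk (T.R_touching C)
      simp only [hks, hkR, or_false, not_false_iff, and_true, false_and]

/-- ★★ **ADDING `E` IS A BIJECTION ONTO THE CONFIGURATIONS OF `D'` WITH THAT HALF-PATH**: for `ξ ⊆ H_G`, `ξ ∪ E ∈ W^{D'}_z(s)` iff `ξ ∈ W^{Dc}_z(s)` (`z = side v i` an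
`H_G`-edge, `s` one of its two faces). [cite: KhristoforovSmirnov2021, §1.2 (arXiv v1 pp. 2–3); §2 Definition 3 (p. 4)] -/
theorem union_mem_TXb_iff {ξ : Finset (Sym2 (Site 2))} (hξ : ξ ⊆ hBonds D₁) {v : HexVertex} {i : Fin 3} (hz : side v i ∈ hBonds D₁) {s : HexVertex}
    (hs : s ∈ triFacesTouching D₁.verts) : ξ ∪ E ∈ TXb D' v i s ↔ ξ ∈ TXb Dc v i s := by
  rw [mem_TXb_iff, mem_TXb_iff, T.parityIs_union_iff C hξ hs, hBonds_eq_of_verts_eq' (D := D₁) C.verts]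
  refine and_congr ⟨fun h1 b hb => ?_, fun h1 b hb => ?_⟩ Iff.rfl
  · exact Finset.mem_erase.2 ⟨(Finset.mem_erase.1 (h1 (Finset.mem_union_left _ hb))).1, hξ hb⟩
  · rcases Finset.mem_union.1 hb with hb | hb
    · exact Finset.mem_erase.2 ⟨(Finset.mem_erase.1 (h1 hb)).1, T.hBonds₁_subset (hξ hb)⟩
    · refine Finset.mem_erase.2 ⟨?_, T.E_subset' C hb⟩
      rintro rfl
      obtain ⟨k, hk, e⟩ := C.sub _ hb
      exact T.nb_not_mem_hBonds₁ hk (e ▸ hz)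

/-- ★ **the partner of `s` corresponds.** [cite: KhristoforovSmirnov2021, §2 Definition 3 (arXiv v1 p. 4: the event `z ↔ u_j`)] -/
theorem inClassX_union_iff {ξ : Finset (Sym2 (Site 2))} (hξ : ξ ⊆ hBonds D₁) {v : HexVertex} {i : Fin 3} (hz : side v i ∈ hBonds D₁) {s : HexVertex}
    (hs : s ∈ triFacesTouching D₁.verts) (j : Fin nm) :
    InClassX D' (faceVertex v (i + 1)) (faceVertex v (i + 2)) s j (ξ ∪ E) ↔ InClassX Dc (faceVertex v (i + 1)) (faceVertex v (i + 2)) s j ξ := by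
  rw [hbK_inClassX_iff, hbK_inClassX_iff]
  refine and_congr (T.union_mem_TXb_iff C hξ hz hs) ?_
  by_cases hj : j = i₀
  · subst hj
    rw [T.yc'_i₀, C.ycc_i₀, SimpleGraph.reachable_comm, T.reachable_a_union_iff C hξ hs, SimpleGraph.reachable_comm]
  · rw [T.yc' j hj, C.ycc j hj]
    exact T.reachable_union_iff C hξ hs (yc_mem_touching D₁ j)

/-- ★ **the link relation corresponds.** [cite: KhristoforovSmirnov2021, §1.2 (arXiv v1 p. 2: the link pattern `IP(ξ)`)] -/
theorem linkRel_union_eq {ξ : Finset (Sym2 (Site 2))} (hξ : ξ ⊆ hBonds D₁) : linkRel D' (ξ ∪ E) = linkRel Dc ξ := by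
  ext ⟨c, d⟩
  rw [mem_linkRel, mem_linkRel, xiLinked_iff_reachable, xiLinked_iff_reachable]
  refine and_congr Iff.rfl ?_
  by_cases hc : c = i₀ <;> by_cases hd : d = i₀
  · subst hc; subst hd
    exact ⟨fun _ => SimpleGraph.Reachable.refl _, fun _ => SimpleGraph.Reachable.refl _⟩
  · subst hc
    rw [T.yc'_i₀, C.ycc_i₀, T.yc' d hd, C.ycc d hd]
    exact T.reachable_a_union_iff C hξ (yc_mem_touching D₁ d)
  · subst hd
    rw [T.yc'_i₀, C.ycc_i₀, T.yc' c hc, C.ycc c hc, SimpleGraph.reachable_comm, T.reachable_a_union_iff C hξ (yc_mem_touching D₁ c),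
      SimpleGraph.reachable_comm]
  · rw [T.yc' c hc, C.ycc c hc, T.yc' d hd, C.ycc d hd]
    exact T.reachable_union_iff C hξ (yc_mem_touching D₁ c) (yc_mem_touching D₁ d)

/-- **restriction**: a configuration of `D'` whose new bonds are exactly `E` is `ξ ∪ E` with `ξ` its `H_G`-part. [cite: KhristoforovSmirnov2021, §1.2 (arXiv v1 p. 2)] -/
theorem eq_filter_union {ζ : Finset (Sym2 (Site 2))} (hζ : ζ ⊆ hBonds D') (hE : ∀ k : Fin 6, k ≤ m → (nbond h (r + k) ∈ ζ ↔ nbond h (r + k) ∈ E)) :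
    ζ = ζ.filter (· ∈ hBonds D₁) ∪ E ∧ ζ.filter (· ∈ hBonds D₁) ⊆ hBonds D₁ := by
  classical
  refine ⟨?_, fun b hb => (Finset.mem_filter.1 hb).2⟩
  ext b
  rw [Finset.mem_union, Finset.mem_filter]
  constructor
  · intro hb
    rcases (T.mem_hBonds'_iff).1 (hζ hb) with h1 | ⟨k, hk, rfl⟩
    · exact Or.inl ⟨hb, h1⟩
    · exact Or.inr ((hE k hk).1 hb)
  · rintro (⟨hb, -⟩ | hb)
    · exact hb
    · obtain ⟨k, hk, rfl⟩ := C.sub b hb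
      exact (hE k hk).2 hb

/-- the `H_G`-part of `ξ ∪ E` is `ξ`. [cite: KhristoforovSmirnov2021, §1.2 (arXiv v1 p. 2)] -/
theorem filter_union_eq {ξ : Finset (Sym2 (Site 2))} (hξ : ξ ⊆ hBonds D₁) : (ξ ∪ E).filter (· ∈ hBonds D₁) = ξ := by
  classical
  ext b
  rw [Finset.mem_filter, Finset.mem_union]
  constructor
  · rintro ⟨hb | hb, hb₁⟩
    · exact hb
    · obtain ⟨k, hk, rfl⟩ := C.sub b hb
      exact absurd hb₁ (T.nb_not_mem_hBonds₁ hk)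
  · exact fun hb => ⟨Or.inl hb, hξ hb⟩

open Classical in
/-- ★★ **THE CLASS COUNTS CORRESPOND**: the configurations of `D'` at `z` (odd face `s`) with new bonds exactly `E`, partner `u_j` and link relation `L` are equinumerous with the
configurations of `Dc` at `z` with partner `u_j` and link relation `L`. [cite: KhristoforovSmirnov2021, §1.2 (arXiv v1 p. 2) and §2 Definition 3 (p. 4)] -/
theorem card_filter_case_eq {v : HexVertex} {i : Fin 3} (hz : side v i ∈ hBonds D₁) {s : HexVertex} (hs : s ∈ triFacesTouching D₁.verts) (j : Fin nm)
    (L : Finset (Fin nm × Fin nm)) :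
    #((TXb D' v i s).filter fun ζ => (InClassX D' (faceVertex v (i + 1)) (faceVertex v (i + 2)) s j ζ ∧ linkRel D' ζ = L) ∧
        ∀ k : Fin 6, k ≤ m → (nbond h (r + k) ∈ ζ ↔ nbond h (r + k) ∈ E)) =
      #((TXb Dc v i s).filter fun ξ => InClassX Dc (faceVertex v (i + 1)) (faceVertex v (i + 2)) s j ξ ∧ linkRel Dc ξ = L) := by
  refine Finset.card_bij (fun ζ _ => ζ.filter (· ∈ hBonds D₁)) (fun ζ hζ => ?_) (fun ζ₁ h₁ ζ₂ h₂ e => ?_) (fun ξ hξ => ?_)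
  · rw [Finset.mem_filter] at hζ ⊢
    obtain ⟨hmem, ⟨hcl, hL⟩, hE⟩ := hζ
    have hsub : ζ ⊆ hBonds D' := fun b hb => (Finset.mem_erase.1 (((mem_TXb_iff (D := D') v i s ζ).1 hmem).1 hb)).2
    obtain ⟨e, hξ⟩ := T.eq_filter_union C hsub hE
    rw [e] at hmem hcl hL
    exact ⟨(T.union_mem_TXb_iff C hξ hz hs).1 hmem, (T.inClassX_union_iff C hξ hz hs j).1 hcl, (T.linkRel_union_eq C hξ) ▸ hL⟩
  · rw [Finset.mem_filter] at h₁ h₂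
    have hsub₁ : ζ₁ ⊆ hBonds D' := fun b hb => (Finset.mem_erase.1 (((mem_TXb_iff (D := D') v i s ζ₁).1 h₁.1).1 hb)).2
    have hsub₂ : ζ₂ ⊆ hBonds D' := fun b hb => (Finset.mem_erase.1 (((mem_TXb_iff (D := D') v i s ζ₂).1 h₂.1).1 hb)).2
    rw [(T.eq_filter_union C hsub₁ h₁.2.2).1, (T.eq_filter_union C hsub₂ h₂.2.2).1, e]
  · rw [Finset.mem_filter] at hξ
    obtain ⟨hmem, hcl, hL⟩ := hξ
    have hξ₁ : ξ ⊆ hBonds D₁ := by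
      intro b hb
      have := ((mem_TXb_iff (D := Dc) v i s ξ).1 hmem).1 hb
      rw [hBonds_eq_of_verts_eq' (D := D₁) C.verts] at this
      exact (Finset.mem_erase.1 this).2
    refine ⟨ξ ∪ E, ?_, T.filter_union_eq C hξ₁⟩
    rw [Finset.mem_filter]
    refine ⟨(T.union_mem_TXb_iff C hξ₁ hz hs).2 hmem, ⟨(T.inClassX_union_iff C hξ₁ hz hs j).2 hcl, by rw [T.linkRel_union_eq C hξ₁]; exact hL⟩,
      fun k hk => ?_⟩
    rw [Finset.mem_union]
    exact ⟨fun h1 => h1.resolve_left fun h2 => T.nb_not_mem_hBonds₁ hk (hξ₁ h2), fun h1 => Or.inr h1⟩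

end Core

/-! ### The parity walk along the outer path -/

/-- ★ **THE PARITY WALK**: in a configuration of `D'` (at an `H_G`-edge, odd face touching `G`) the presence of the new bonds `nb k`, `k ≤ m`, is constant in `k` except for ONE
flip at `a`: `nb k` is present iff (`nb 0` is present iff `k ≤ k₀`). [cite: KhristoforovSmirnov2021, §1.2 (arXiv v1 pp. 2–3: prescribed disorders)] -/
theorem nbond_mem_iff_of_mem_TXb {v : HexVertex} {i : Fin 3} {s : HexVertex} (hs : s ∈ triFacesTouching D₁.verts) {ζ : Finset (Sym2 (Site 2))}
    (hζ : ζ ∈ TXb D' v i s) {k : Fin 6} (hk : k ≤ m) : nbond h (r + k) ∈ ζ ↔ (nbond h r ∈ ζ ↔ k ≤ k₀) := by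
  obtain ⟨hsub, hpar⟩ := (mem_TXb_iff (D := D') v i s ζ).1 hζ
  have hsub' : ζ ⊆ hBonds D' := fun b hb => (Finset.mem_erase.1 (hsub hb)).2
  -- one step: the flip happens exactly at `a`
  have step : ∀ k : Fin 6, k < m → (¬ (nbond h (r + (k + 1)) ∈ ζ ↔ nbond h (r + k) ∈ ζ) ↔ k = k₀) := by
    intro k hk'
    have hp := hpar (leftFaceDir h (r + k)) (T.N_touching' k)
    rw [odd_xiDeg_iff_not_iff (leftFaceIdx (r + k)) (fun hm => T.outer_not_mem_hBonds' hk' (by rw [← side_N_idx]; exact hsub' hm)), side_N_idx_add_one,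
      side_N_idx_add_two, add_assoc, Finset.mem_symmDiff, Finset.mem_singleton, (T.N_corners hk').1] at hp
    have hks : leftFaceDir h (r + k) ≠ s := fun e => T.N_not_touching hk' (e ▸ hs)
    simpa only [hks, not_false_iff, and_true, false_and, or_false] using hp
  suffices H : ∀ n : ℕ, ∀ k : Fin 6, k.val = n → k ≤ m → (nbond h (r + k) ∈ ζ ↔ (nbond h r ∈ ζ ↔ k ≤ k₀)) from H k.val k rfl hk
  intro n
  induction n with
  | zero =>
    intro k hk0 _
    have e : k = 0 := Fin.ext hk0
    subst e
    simp only [add_zero, Fin.zero_le, iff_true]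
  | succ n ih =>
    intro k hkn hkm
    obtain ⟨hv, hs'⟩ := fin_pred (k := k) (by omega)
    have hlt : k + 5 < m := by rw [Fin.lt_def, hv]; rw [Fin.le_def] at hkm; omega
    have h1 := ih (k + 5) (by rw [hv]; omega) hlt.le
    have h2 := step (k + 5) hlt
    rw [hs'] at h2
    have hle : (k ≤ k₀ ↔ (k + 5 ≤ k₀ ∧ k + 5 ≠ k₀)) := by
      rw [Fin.le_def, Fin.le_def, Ne, Fin.ext_iff, hv]; omega
    rw [hle]
    by_cases hU : k + 5 = k₀
    · have hV : k + 5 ≤ k₀ := hU.le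
      have hXY : ¬ (nbond h (r + k) ∈ ζ ↔ nbond h (r + (k + 5)) ∈ ζ) := h2.2 hU
      have h1' : (nbond h (r + (k + 5)) ∈ ζ ↔ nbond h r ∈ ζ) := by
        rw [h1]; exact ⟨fun h' => h'.2 hV, fun h' => ⟨fun _ => hV, fun _ => h'⟩⟩
      have hF : ¬ (k + 5 ≤ k₀ ∧ k + 5 ≠ k₀) := fun h' => h'.2 hU
      rw [iff_false_intro hF]
      rw [h1'] at hXY
      constructor
      · intro hX; exact ⟨fun hZ => hXY ⟨fun _ => hZ, fun _ => hX⟩, fun hf => hf.elim⟩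
      · intro hZ
        by_contra hX
        exact hXY ⟨fun hX' => absurd hX' hX, fun hZ' => absurd hZ' (fun hZ'' => (hZ.1 hZ''))⟩
    · have hXY : (nbond h (r + k) ∈ ζ ↔ nbond h (r + (k + 5)) ∈ ζ) := by
        by_contra hne; exact hU (h2.1 hne)
      have hT : (k + 5 ≤ k₀ ∧ k + 5 ≠ k₀) ↔ k + 5 ≤ k₀ := ⟨fun h' => h'.1, fun h' => ⟨h', hU⟩⟩
      rw [hXY, h1, hT]

/-- **the two cases**: the new bonds of a configuration of `D'` are exactly `EQ` (when `nb m` is present) or exactly `EP` (when it is not).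
[cite: KhristoforovSmirnov2021, §1.2 (arXiv v1 pp. 2–3)] -/
theorem cases_of_mem_TXb {v : HexVertex} {i : Fin 3} {s : HexVertex} (hs : s ∈ triFacesTouching D₁.verts) {ζ : Finset (Sym2 (Site 2))}
    (hζ : ζ ∈ TXb D' v i s) :
    (nbond h (r + m) ∈ ζ → ∀ k : Fin 6, k ≤ m → (nbond h (r + k) ∈ ζ ↔ nbond h (r + k) ∈ EQ h r m k₀)) ∧
      (nbond h (r + m) ∉ ζ → ∀ k : Fin 6, k ≤ m → (nbond h (r + k) ∈ ζ ↔ nbond h (r + k) ∈ EP h r k₀)) := by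
  have hm := T.nbond_mem_iff_of_mem_TXb hs hζ (le_refl m)
  have hm0 : ¬ m ≤ k₀ := not_le.2 T.k₀_lt
  constructor
  · intro hin k hk
    rw [T.nbond_mem_iff_of_mem_TXb hs hζ hk, nbond_mem_EQ_iff]
    have h0 : nbond h r ∉ ζ := fun h0 => hm0 ((hm.1 hin).1 h0)
    simp only [h0, false_iff, not_le, hk, and_true]
  · intro hout k hk
    rw [T.nbond_mem_iff_of_mem_TXb hs hζ hk, nbond_mem_EP_iff]
    have h0 : nbond h r ∈ ζ := by
      by_contra h0
      exact hout (hm.2 ⟨fun h1 => absurd h1 h0, fun h1 => absurd h1 hm0⟩)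
    simp only [h0, true_iff]

/-! ## §4 The slide identity -/

open Classical in
/-- the class count of `D'` at one half of the edge splits into the two cases. [cite: KhristoforovSmirnov2021, §1.2 (arXiv v1 p. 2) and §2 Definition 3 (p. 4)] -/
theorem card_filter_eq_add {v : HexVertex} {i : Fin 3} (hz : side v i ∈ hBonds D₁) {s : HexVertex} (hs : s ∈ triFacesTouching D₁.verts) (j : Fin nm)
    (L : Finset (Fin nm × Fin nm)) :
    #((TXb D' v i s).filter fun ζ => InClassX D' (faceVertex v (i + 1)) (faceVertex v (i + 2)) s j ζ ∧ linkRel D' ζ = L) =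
      #((TXb D₁ v i s).filter fun ξ => InClassX D₁ (faceVertex v (i + 1)) (faceVertex v (i + 2)) s j ξ ∧ linkRel D₁ ξ = L) +
        #((TXb D₂ v i s).filter fun ξ => InClassX D₂ (faceVertex v (i + 1)) (faceVertex v (i + 2)) s j ξ ∧ linkRel D₂ ξ = L) := by
  rw [← T.card_filter_case_eq T.caseQ hz hs j L, ← T.card_filter_case_eq T.caseP hz hs j L,
    ← Finset.card_filter_add_card_filter_not (fun ζ => nbond h (r + m) ∈ ζ), Finset.filter_filter, Finset.filter_filter]
  congr 1
  · congr 1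
    refine Finset.filter_congr fun ζ hζ => ⟨fun ⟨hc, hin⟩ => ⟨hc, (T.cases_of_mem_TXb hs hζ).1 hin⟩, fun ⟨hc, hE⟩ => ⟨hc, ?_⟩⟩
    rw [hE m le_rfl, nbond_mem_EQ_iff]; exact ⟨T.k₀_lt, le_rfl⟩
  · congr 1
    refine Finset.filter_congr fun ζ hζ => ⟨fun ⟨hc, hout⟩ => ⟨hc, (T.cases_of_mem_TXb hs hζ).2 hout⟩, fun ⟨hc, hE⟩ => ⟨hc, ?_⟩⟩
    rw [hE m le_rfl, nbond_mem_EP_iff]; exact not_le.2 T.k₀_lt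

/-- ★★★ **THE SLIDE IDENTITY FOR THE PATTERN COUNTS**: at every `H_G`-edge `z = side v i` and for every pattern `p` (partner and link relation of the corners),
`N_p^{D'}(z) = N_p^{D₁}(z) + N_p^{D₂}(z)` — moving ONE mark from the contact end `q` (domain `D₁`) across the attached hexagon `h` to the outer-path vertex `a` (domain `D'`)
costs exactly the law of the domain with the mark at the other contact end `p` (domain `D₂`). (HOME `FINDING-BSPAN-SLIDE-INDUCTION.md` §2 SLIDE:
`law(Ω ∪ h; M − q + a) = law(Ω; M) + law(Ω; M − q + p)`.) [cite: KhristoforovSmirnov2021, §1.2 (arXiv v1 p. 2: the law of the link pattern), §2 Definition 3 (p. 4); BollobasRiordan2006, Ch. 7 §7.2.2 pp. 168–169] -/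
theorem patternCount_eq_add {v : HexVertex} {i : Fin 3} (hz : side v i ∈ hBonds D₁) (p : Pat nm) :
    patternCount D' v i p = patternCount D₁ v i p + patternCount D₂ v i p := by
  have hv : v ∈ triFacesTouching D₁.verts := mem_touching_of_side_mem D₁ hz
  have ho : oppFace v i ∈ triFacesTouching D₁.verts := mem_touching_of_side_mem D₁ (j := oppIdx v i) (by rw [side_oppFace_oppIdx]; exact hz)
  unfold patternCount
  rw [T.card_filter_eq_add hz hv p.1.1 p.1.2, T.card_filter_eq_add hz ho p.1.1 p.1.2]
  ring

omit T in
/-- ★★★ **THE SLIDE IDENTITY IN THE PLANAR TEMPERLEY–LIEB MODULE**: for home-arc boundary mid-edges `z'`, `z₁`, `z₂` of `D'`, `D₁`, `D₂` read at the same face and side,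
`lawLP z' = lawLP z₁ + lawLP z₂`. [cite: KhristoforovSmirnov2021, §1.2 (arXiv v1 p. 2: the law of the link pattern); PearceRittenbergDeGierNienhuis2002, §2 (the link-pattern module)] -/
theorem lawLP_eq_add {n : ℕ} {D' D₁ D₂ : TriMarkedDomain (n + 1)} {h : Site 2} {r m k₀ : Fin 6} {i₀ : Fin (n + 1)} (T : SlideData D' D₁ D₂ h r m k₀ i₀)
    (z' : ArcPoint D' (Fin.last n)) (z₁ : ArcPoint D₁ (Fin.last n)) (z₂ : ArcPoint D₂ (Fin.last n)) (hv' : z'.v = z₁.v) (hi' : z'.i = z₁.i)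
    (hv₂ : z₂.v = z₁.v) (hi₂ : z₂.i = z₁.i) : lawLP z' = lawLP z₁ + lawLP z₂ := by
  refine Finsupp.ext fun Q => ?_
  rw [Finsupp.add_apply, lawLP_apply, lawLP_apply, lawLP_apply, hv', hi', hv₂, hi₂, T.patternCount_eq_add (z₁.allSides z₁.i)]
  push_cast
  rfl

end SlideData

end Slide

end Literature.Probability.Percolation.MarkedLoops
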